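import Literature.NumberTheory.Automorphic.RankinSelbergUnfoldingIdentity
import Literature.NumberTheory.Automorphic.RankinSelbergUnfoldedEulerCuspidal
import Literature.NumberTheory.Automorphic.PairLFunctionPolesEqConjOneFamily
import Literature.NumberTheory.Automorphic.RankinSelbergTorusPositivity
import Literature.NumberTheory.Automorphic.CuspidalTestVector
import Literature.NumberTheory.Automorphic.SmoothedCuspFormGeneric
import Literature.NumberTheory.Automorphic.WhittakerCoeffCentral
import Literature.NumberTheory.Automorphic.AdeleAddCharUnramified
import Literature.NumberTheory.Automorphic.AutomorphicLFunctionFlathProofs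
import Literature.NumberTheory.Automorphic.StandardTestFunGaussian
import Literature.NumberTheory.Automorphic.GLnCuspidalSpectrumProofs
import Literature.NumberTheory.Automorphic.SatakeParameterGenericBoundHolds
import Literature.NumberTheory.Automorphic.LocalComponentGenericHolds
import HarnessLib

/-!
# Arthur–Clozel (2.3) — the pole of `L^S(s, π ⊗ π̃)` at `s = 1` — from the LOCAL Rankin–Selberg inputs

Topic `NumberTheory/Automorphic`; namespace `Literature.NumberTheory.Automorphic`. Proof file (theorems
only: no definition, no named fact) under the named fact `JacquetShalika1981_partialPairL_pole_of_eq_conj`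
(`PairLFunctionPoles`; Arthur–Clozel (1989), Ch. 3 §2 (2.3); Jacquet–Shalika II, Prop. 3.6). The printed
proof is the global Rankin–Selberg method for the pair `(π̄, π)` (Jacquet–Shalika I, §4; Cogdell (2004),
§2.3 and §4.2): `I(s; φ̄, φ, Φ) = A(s) L^S(s, π × π̃)`, `(s - 1) I(s) → c Φ̂(0) ‖φ‖² ≠ 0`, and the LOCAL
theory at the finitely many bad places (`A(s) → A(1) ≠ 0`). The tree now contains the whole GLOBAL half,
proved in the honest `L²` model for every `n ≥ 1`:

* the residue `(s - 1) I(s; φ̄̃, φ̃, Φ) → r ≠ 0` (`RankinSelbergResidueDatum`);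
* the unfolding identity `I(s; φ̄̃, φ̃, Φ) = C Ψ(s; W_φ, W̄_φ, Φ)` on `1 < Re s < 2`
  (`RankinSelbergUnfoldingIdentity`);
* the Euler factorisation `Ψ(s; W_φ, W̄_φ, Φ) = L^{S'}(s, α ⊗ ᾱ) · Ψ_{S'}(s)` on `Re s > 1`, `Ψ_{S'}` the
  integral over the torus points which are units off `S'` (`RankinSelbergUnfoldedEulerCuspidal`);
* the change of `S` and of the Satake families (`PairLFunctionPolesEqConjOneFamily`).

This file assembles them: `JacquetShalika1981_partialPairL_pole_of_eq_conj_of_local` proves the named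
fact from the two LOCAL inputs of the printed proof, stated as hypotheses —

* `hlt` — Jacquet–Shalika's strict bound `|a| < q_v^{1/2}` for the Satake parameters of cuspidal
  representations at unramified places (loc. cit. I, Cor. (2.5); in the tree a consequence of the local
  named facts via `norm_satakeParameter_lt_sqrt_of_isGeneric`), which moves finitely many unramified
  Euler factors;
* `hloc` — the local Rankin–Selberg theory at the bad places at `s = 1`: for the datum of the method
  (a smoothed cusp form `S_η f`, its Whittaker coefficient `W_φ`, the Gaussian standard test function
  `Φ`, a finite set `S'` of finite places and Haar measures) the `S'`-part
  `Ψ_{S'}(s) = ∫_{B({v ∉ S'}) × K} |W_φ(diag(a) k)|² Φ(e_n diag(a) k) |det a|^s δ_B(a)⁻¹` has a finite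
  NON-ZERO limit as `s → 1`, `Re s > 1` (loc. cit. I, §1 Prop. (1.?)/(3.17): absolute convergence of the
  archimedean and ramified local integrals of unitary generic representations for `Re s ≥ 1`, and their
  positivity for `W' = W̄`, `Φ ≥ 0`).

The rank `n = 0` is excluded by the fact's hypothesis `0 < n`; for `n = 1` the fact is proved outright
in `PairLFunctionPolesGLOneDedekindProofs`.

## References

* J. Arthur, L. Clozel, *Simple algebras, base change, and the advanced theory of the trace formula*,
  Ann. of Math. Stud. 120 (1989), Ch. 3 §2, (2.3) [ArthurClozelAMS120].
* H. Jacquet, J. A. Shalika, *On Euler products and the classification of automorphic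
  representations I, II*, Amer. J. Math. 103 (1981) [JacquetShalikaAJM1981].
* J. W. Cogdell, *Analytic theory of L-functions for GL_n*, in *An Introduction to the Langlands
  Program* (2004), §2.3, §4.2 [CogdellAnalyticTheory2004].
-/

noncomputable section

open MeasureTheory Measure NumberField IsDedekindDomain Matrix Set Filter Finset Topology
open scoped MatrixGroups ENNReal NNReal Pointwise ValuativeRel ComplexConjugate
open Literature.RingTheory.SymmetricFunctions.SymmPoly
open Literature.NumberTheory.GaloisRepresentations (ideleGroup)

namespace Literature.NumberTheory.Automorphic

-- the automorphic quotient carries the tree's Borel σ-algebra, not Mathlib's quotient σ-algebra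
attribute [-instance] Quotient.instMeasurableSpace QuotientGroup.measurableSpace

section TestFun

variable (n : ℕ) (K : Type) [Field K] [NumberField K]

/-- **The standard test function `Φ_∞ ⊗ 𝟙_{𝒪̂ⁿ}` is continuous for continuous `Φ_∞`** (`𝒪̂ⁿ` is clopen;
the proof of `continuous_standardTestFun_jsArchTestFun` for a general archimedean factor). [folklore] -/
theorem continuous_standardTestFun_of_continuous {Φinf : (Fin n → InfiniteAdeleRing K) → ℝ}
    (hΦ : Continuous Φinf) : Continuous (standardTestFun n K Φinf) := by
  have hU : IsClopen {y : Fin n → AdeleRing (𝓞 K) K | ∀ (i : Fin n) (w : HeightOneSpectrum (𝓞 K)),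
      (y i).2 w ∈ w.adicCompletionIntegers K} :=
    (isClopen_integralFiniteAdeleVec n K).preimage (continuous_pi fun i => continuous_snd.comp (continuous_apply i))
  have hf : Continuous fun y : Fin n → AdeleRing (𝓞 K) K => Φinf fun i => (y i).1 :=
    hΦ.comp (continuous_pi fun i => continuous_fst.comp (continuous_apply i))
  have heq : standardTestFun n K Φinf =
      {y : Fin n → AdeleRing (𝓞 K) K | ∀ (i : Fin n) (w : HeightOneSpectrum (𝓞 K)),
        (y i).2 w ∈ w.adicCompletionIntegers K}.indicator fun y => Φinf fun i => (y i).1 := by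
    funext y
    unfold standardTestFun
    classical
    rw [Set.indicator_apply]
    rfl
  rw [heq]
  exact hU.continuous_indicator hf

end TestFun

section Local

variable {n : ℕ} {K : Type} [Field K] [NumberField K]
variable {μ' : Measure (AdelicGroupData.gl n K).automorphicQuotient}
  [(AdelicGroupData.gl n K).IsAutomorphicMeasure μ']

-- the house local instances: Borel structures of `GL_n(𝔸_K)` in both spellings; none overrides a
-- Mathlib instance
attribute [local instance] adelicBorel borelSpace_adelic locallyCompactSpace_adelic secondCountableTopology_gl_adelic
  glAdeleBorel borelSpace_glAdele

/-- **Arthur–Clozel (2.3) from the local Rankin–Selberg inputs.** The named fact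
`JacquetShalika1981_partialPairL_pole_of_eq_conj` — for unitary cuspidal `π ≅ σ̃` on `GL_n(𝔸_K)`,
`0 < n`, every finite `S` and all Satake families `α`, `β` of `π`, `σ` off `S`,
`lim_{s → 1, Re s > 1} (s - 1) L^S(s, α ⊗ β)` exists, finite and non-zero — follows from the GLOBAL
Rankin–Selberg method of the tree together with the two LOCAL inputs of the printed proof:
`hlt`, Jacquet–Shalika's strict bound `|a| < q_v^{1/2}` at unramified places (I, Cor. (2.5)), and
`hloc`, the convergence to a non-zero limit at `s = 1` of the `S'`-part `Ψ_{S'}(s)` of the unfolded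
integral of the datum (I, §1 and §3: the local archimedean and ramified Rankin–Selberg integrals of
unitary generic representations at `Re s = 1`). Assembly: residue (`exists_residue_datum`), unfolding on
the strip (`exists_rankinSelbergIntegral_eq_mul_rankinSelbergTorusIntegralC`), Euler factorisation
(`rankinSelbergTorusIntegralC_whittakerCoeff_eq_partialPairL_mul`), glue
(`exists_ne_zero_tendsto_mul_of_eventuallyEq`), change of `S`
(`JacquetShalika1981_partialPairL_pole_of_eq_conj_of_one_family'`).
[cite: ArthurClozelAMS120, Ch. 3 §2 (2.3)] [cite: JacquetShalikaAJM1981, §4; Cor. (2.5); II Prop. 3.6] -/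
theorem JacquetShalika1981_partialPairL_pole_of_eq_conj_of_local
    (hlt : ∀ (P : CuspidalAutomorphicRepGL n K μ') {S : Set (HeightOneSpectrum (𝓞 K))}
      {α : SatakeFamily K} (_hα : IsSatakeFamilyOf P S α) {v : HeightOneSpectrum (𝓞 K)}
      (_hv : v ∉ S) {a : ℂ} (_ha : a ∈ α v), ‖a‖ < Real.sqrt v.residueCard)
    (hloc : ∀ [MeasurableSpace (AdeleRing (𝓞 K) K)] [BorelSpace (AdeleRing (𝓞 K) K)]
      (P : CuspidalAutomorphicRepGL n K μ') (f : P.1.toSubmodule)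
      (η : (AdelicGroupData.gl n K).Adelic → ℝ) (_hη : IsTestFunctionGL n K η)
      (S' : Set (HeightOneSpectrum (𝓞 K))) (_hS' : S'.Finite)
      (νA : Measure (Fin n → ideleGroup K)) (_ : IsHaarMeasure νA)
      (νK : Measure ↥(maximalCompactAdelic n K)) (_ : IsHaarMeasure νK)
      (ν₀ : Measure ↥(adelicUnipotent n K)) (_ : IsHaarMeasure ν₀),
      ∃ ℓ : ℂ, ℓ ≠ 0 ∧
        Tendsto (fun s : ℂ => ∫ p in unitBox {v | v ∉ S'} ×ˢ Set.univ, torusIntegrandC n K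
            (whittakerCoeff ν₀ (unipotentTateDomain n K) (adeleAddChar K)
              (invQuot (AdelicGroupData.gl n K) (smoothedForm η (f : (AdelicGroupData.gl n K).L2 μ'))))
            (standardTestFun n K (gaussArchTestFun n K)) s p ∂(νA.prod νK))
          (𝓝[{s : ℂ | 1 < s.re}] 1) (𝓝 ℓ)) :
    JacquetShalika1981_partialPairL_pole_of_eq_conj (n := n) (K := K) (μ := μ') := by
  refine JacquetShalika1981_partialPairL_pole_of_eq_conj_of_one_family'
    JacquetShalika1981_multipliable_partialPairL_holds hlt fun hn P => ?_
  classical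
  -- topological and measurable structures
  haveI : T2Space (GL (Fin n) (AdeleRing (𝓞 K) K)) := t2Space_gl n K
  haveI : LocallyCompactSpace (GL (Fin n) (AdeleRing (𝓞 K) K)) :=
    AdelicGroupData.locallyCompactSpace_generalLinearGroup_adeleRing K (Fin n)
  haveI := secondCountableTopology_generalLinearGroup_adeleRing K (Fin n)
  haveI : T2Space (AdeleRing (𝓞 K) K) := t2Space_adeleRing K
  letI : MeasurableSpace (AdeleRing (𝓞 K) K) := borel _
  haveI : BorelSpace (AdeleRing (𝓞 K) K) := ⟨rfl⟩
  haveI := borelSpace_ideleGroup K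
  haveI := locallyCompactSpace_ideleGroup K
  haveI := secondCountableTopology_ideleGroup K
  haveI := secondCountableTopology_adeleRing K
  haveI := locallyCompactSpace_adeleRing' K
  haveI : CompactSpace ↥(maximalCompactAdelic n K) :=
    isCompact_iff_compactSpace.1 (isCompact_maximalCompactAdelic n K)
  haveI : LocallyCompactSpace ↥(adelicUnipotent n K) := (isClosed_adelicUnipotent n K).locallyCompactSpace
  -- Haar measures
  obtain ⟨νI, hνI⟩ := exists_isHaarMeasure_ideleGroup K
  haveI hνIR : νI.IsMulRightInvariant := by
    haveI := isInvInvariant_of_isHaarMeasure_ideleGroup (K := K) νI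
    infer_instance
  set μ : Measure (Fin n → AdeleRing (𝓞 K) K) := Measure.addHaar with hμ
  set νA : Measure (Fin n → ideleGroup K) := Measure.haar with hνA
  set νK : Measure ↥(maximalCompactAdelic n K) := Measure.haar with hνK
  set ν₀ : Measure ↥(adelicUnipotent n K) := Measure.haar with hν₀
  haveI hν₀R : ν₀.IsMulRightInvariant := isMulRightInvariant_of_isHaarMeasure_adelicUnipotent ν₀
  -- (1) a Satake family and a test vector with a level
  obtain ⟨S₁, β₀, -, hβ₀⟩ := exists_isSatakeFamilyOf_holds (n := n) (K := K) (μ := μ') P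
  obtain ⟨f, η, hη, -, hne, 𝔫₀, h𝔫₀, hηK⟩ := P.exists_isTestFunctionGL_smoothedForm_ne_zero
  have hηc : Continuous η := hη.continuous
  have hηs : HasCompactSupport η := hη.hasCompactSupport
  have hcusp : ((f : P.1.toSubmodule) : (AdelicGroupData.gl n K).L2 μ') ∈ cuspidalSubspace n K μ' :=
    P.le_cuspidalSubspace f.2
  -- (2) the Whittaker coefficient: continuity, a non-vanishing torus point with integral last entry
  have hψ : IsGlobalAddChar K (adeleAddChar K) := isGlobalAddChar_adeleAddChar (K := K)
  have h𝓕 : IsFundamentalDomain ↥(rationalUnipotent n K) (unipotentTateDomain n K) ν₀ :=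
    isFundamentalDomain_unipotentTateDomain ν₀
  have h𝓕c : IsCompact (closure (unipotentTateDomain n K)) := isCompact_closure_unipotentTateDomain
  have h𝓕m : MeasurableSet (unipotentTateDomain n K) := measurableSet_unipotentTateDomain
  set φ : GL (Fin n) (AdeleRing (𝓞 K) K) → ℂ :=
    invQuot (AdelicGroupData.gl n K) (smoothedForm η ((f : P.1.toSubmodule) : (AdelicGroupData.gl n K).L2 μ'))
    with hφ
  have hφc : Continuous φ := continuous_invQuot_smoothedForm hηc hηs _
  have hφinv : IsLeftInvariant (AdelicGroupData.gl n K) φ := isLeftInvariant_invQuot _ _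
  set W : GL (Fin n) (AdeleRing (𝓞 K) K) → ℂ :=
    whittakerCoeff ν₀ (unipotentTateDomain n K) (adeleAddChar K) φ with hW
  have hWc : Continuous W := continuous_whittakerCoeff h𝓕m h𝓕c hψ.continuous hφc
  have hWN : ∀ u ∈ upperUnitriangular (Fin n) (AdeleRing (𝓞 K) K), ∀ g, ‖W (u * g)‖ = ‖W g‖ := by
    intro u hu g
    have h := whittakerCoeff_unipotent_mul (ν := ν₀) (𝓕 := unipotentTateDomain n K)
      (ψ := adeleAddChar K) h𝓕 hψ hφinv ⟨u, hu⟩ g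
    change W (u * g) = _ * W g at h
    rw [h, norm_mul, whittakerCharFun_apply, Circle.norm_coe, one_mul]
  obtain ⟨g₁, hg₁⟩ := exists_whittakerCoeff_invQuot_smoothedForm_ne_zero_of_one_le hn hηc hηs hcusp hne ν₀
  obtain ⟨a₁, k₀, ha₁⟩ := exists_torusPoint_apply_ne_zero hWN hg₁
  obtain ⟨d, hd0, hdint⟩ := exists_ne_zero_valued_algebraMap_mul_le_one (K := K) (lastEntry a₁)
  have hdK : (d : K) ≠ 0 := RingOfIntegers.coe_ne_zero_iff.mpr hd0
  set c : Kˣ := Units.mk0 (d : K) hdK with hc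
  set ξ : ideleGroup K := Units.map (algebraMap K (AdeleRing (𝓞 K) K) : K →* AdeleRing (𝓞 K) K) c
    with hξ
  have hξval : ((ξ : ideleGroup K) : AdeleRing (𝓞 K) K) = algebraMap K (AdeleRing (𝓞 K) K) (d : K) := by
    rw [hξ, Units.coe_map, hc, Units.val_mk0]
    rfl
  set a₀ : Fin n → ideleGroup K := (fun _ => ξ) * a₁ with ha₀
  have ha₀W : W (torusPoint n K (a₀, k₀)) ≠ 0 := by
    have e : W (torusPoint n K (a₀, k₀)) = W (torusPoint n K (a₁, k₀)) := by
      rw [ha₀, torusPoint_mul, hW, hξ]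
      exact whittakerCoeff_glDiagonal_const_mul ν₀ _ _ hφinv c _
    rw [e]
    exact ha₁
  have hlast : lastEntry a₀ = ξ * lastEntry a₁ := by
    rw [ha₀, lastEntry_mul]
    congr 1
    unfold lastEntry
    rw [dif_pos (by omega : 0 < n)]
  have hint : ∀ w : HeightOneSpectrum (𝓞 K),
      Valued.v (((lastEntry a₀ : ideleGroup K) : AdeleRing (𝓞 K) K).2 w) ≤ 1 := by
    intro w
    rw [hlast, Units.val_mul, hξval]
    exact hdint w
  -- (3) the exceptional finite set `S'` and the good places
  obtain ⟨Sψ, hSψ⟩ := exists_finset_adicComponent_adeleAddChar_unramified (K := K)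
  set S₀ : Finset (HeightOneSpectrum (𝓞 K)) :=
    S₁ ∪ (Ideal.finite_factors h𝔫₀).toFinset ∪ Sψ ∪ (finite_setOf_exists_valued_ne_one a₀).toFinset with hS₀
  set S' : Set (HeightOneSpectrum (𝓞 K)) := ↑S₀ with hS'
  have hS'fin : S'.Finite := S₀.finite_toSet
  have hS₁S' : (↑S₁ : Set (HeightOneSpectrum (𝓞 K))) ⊆ S' := by
    intro v hv
    simp only [hS', hS₀, Finset.coe_union, Set.mem_union, Finset.mem_coe] at hv ⊢
    exact Or.inl (Or.inl (Or.inl hv))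
  have hgood : ∀ v ∉ S', ¬ v.asIdeal ∣ 𝔫₀ ∧ v ∉ Sψ ∧
      ∀ i, Valued.v (((a₀ i : ideleGroup K) : AdeleRing (𝓞 K) K).2 v) = 1 := by
    intro v hv
    have hv0 : v ∉ S₀ := fun h => hv h
    simp only [hS₀, Finset.mem_union, Set.Finite.mem_toFinset, Set.mem_setOf_eq, not_or,
      not_exists, ne_eq, not_not] at hv0
    exact ⟨hv0.1.1.2, hv0.1.2, hv0.2⟩
  have hGood : ∀ v ∉ S', ¬ v.asIdeal ∣ 𝔫₀ ∧
      (∀ c ∈ 𝒪[v.adicCompletion K], (adeleAddChar K).adicComponent v c = 1) ∧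
      ∀ ϖ : v.adicCompletion K, Valued.v ϖ = WithZero.exp (-1 : ℤ) →
        ∃ c ∈ 𝒪[v.adicCompletion K], (adeleAddChar K).adicComponent v (ϖ⁻¹ * c) ≠ 1 := by
    intro v hv
    obtain ⟨h1, h2, -⟩ := hgood v hv
    exact ⟨h1, (hSψ v h2).1, (hSψ v h2).2⟩
  have ha₀unit : a₀ ∈ unitBox {v : HeightOneSpectrum (𝓞 K) | v ∉ S'} := fun v hv i => (hgood v hv).2.2 i
  -- enumerations of the Satake parameters off `S'`
  have hβ₀' : IsSatakeFamilyOf P S' β₀ := hβ₀.mono hS₁S'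
  have hex : ∀ v : HeightOneSpectrum (𝓞 K), ∃ x : Fin n → ℂ,
      v ∉ S' → (Finset.univ : Finset (Fin n)).val.map x = β₀ v := by
    intro v
    by_cases hv : v ∉ S'
    · obtain ⟨x, hx⟩ := exists_univ_val_map_eq (hβ₀'.card_eq hv)
      exact ⟨x, fun _ => hx⟩
    · exact ⟨fun _ => 0, fun h => absurd h hv⟩
  choose x hx using hex
  -- (4) the Gaussian test function
  set Φ : (Fin n → AdeleRing (𝓞 K) K) → ℝ := standardTestFun n K (gaussArchTestFun n K) with hΦ
  have hΦS : (fun y => (Φ y : ℂ)) ∈ piSchwartzBruhat K (Fin n) := standardTestFun_gauss_mem_piSchwartzBruhat n K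
  have hΦ0 : ∀ y, 0 ≤ Φ y := standardTestFun_gauss_nonneg n K
  have hΦc : Continuous Φ := continuous_standardTestFun_of_continuous n K (continuous_gaussArchTestFun n K)
  have hΦm : Measurable fun g : GL (Fin n) (AdeleRing (𝓞 K) K) => Φ (lastRow n K g) :=
    (hΦc.comp continuous_lastRow).measurable
  -- (5) the residue: `(s - 1) I(s) → r ≠ 0`
  obtain ⟨-, r, -, hr, hI⟩ := P.exists_residue_datum hn νI μ hΦS
    (integral_ofReal_standardTestFun_gauss_ne_zero n K μ) hη f hne
  -- (6) the unfolding identity on the strip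
  obtain ⟨C, hC, hunf⟩ :=
    exists_rankinSelbergIntegral_eq_mul_rankinSelbergTorusIntegralC (n := n) (K := K) hn μ' νI νA νK ν₀
  -- (7) the Euler factorisation on `Re s > 1`
  have hEuler : ∀ s : ℂ, 1 < s.re →
      rankinSelbergTorusIntegralC n K νA νK W Φ s =
        partialPairL S' β₀ (conjFamily β₀) s *
          ∫ p in unitBox {v | v ∉ S'} ×ˢ Set.univ, torusIntegrandC n K W Φ s p ∂(νA.prod νK) := by
    intro s hs
    have hfin : rankinSelbergTorusIntegral n K νA νK W Φ s.re ≠ ⊤ :=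
      rankinSelbergTorusIntegral_whittakerCoeff_ne_top_of_mem_piSchwartzBruhat hn νA νK ν₀ P f hη hΦS hΦ0 hΦm hs
    have hpos := setLIntegral_torusIntegrand_unitBox_ne_zero hWc ha₀W ha₀unit hint
      (continuous_gaussArchTestFun n K) (gaussArchTestFun_pos n K) s.re νA νK
    exact rankinSelbergTorusIntegralC_whittakerCoeff_eq_partialPairL_mul hn P hβ₀ h𝔫₀ hηc hηs hηK f h𝓕 h𝓕m
      h𝓕c hψ hS₁S' hGood (fun v hv => hx v hv) (fun z => (gaussArchTestFun_pos n K z).le) hΦm νA νK hs hfin hpos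
  -- (8) the local input
  obtain ⟨ℓ, hℓ, hloc'⟩ := hloc P f η hη S' hS'fin νA inferInstance νK inferInstance ν₀ inferInstance
  -- (9) glue: `(s - 1) L^{S'}(s) → r / (C ℓ)`
  refine ⟨S', β₀, hS'fin, hβ₀', ?_⟩
  have hA : Tendsto (fun s : ℂ => (C : ℂ) *
      ∫ p in unitBox {v | v ∉ S'} ×ˢ Set.univ, torusIntegrandC n K W Φ s p ∂(νA.prod νK))
      (𝓝[{s : ℂ | 1 < s.re}] 1) (𝓝 ((C : ℂ) * ℓ)) := hloc'.const_mul _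
  have hCℓ : (C : ℂ) * ℓ ≠ 0 := mul_ne_zero (Complex.ofReal_ne_zero.2 hC.ne') hℓ
  have hstrip : ∀ᶠ s in 𝓝[{s : ℂ | 1 < s.re}] 1, 1 < s.re ∧ s.re < 2 := by
    have h2 : ∀ᶠ s in 𝓝 (1 : ℂ), s.re < 2 :=
      (Complex.continuous_re.tendsto (1 : ℂ)).eventually (eventually_lt_nhds (by norm_num))
    exact eventually_mem_nhdsWithin.and (eventually_nhdsWithin_of_eventually_nhds h2)
  have hIAL : ∀ᶠ s in 𝓝[{s : ℂ | 1 < s.re}] 1,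
      rankinSelbergIntegral μ' νI (fun y => (Φ y : ℂ)) s
          (star (smoothedForm η ((f : P.1.toSubmodule) : (AdelicGroupData.gl n K).L2 μ')))
          (smoothedForm η ((f : P.1.toSubmodule) : (AdelicGroupData.gl n K).L2 μ')) =
        ((C : ℂ) * ∫ p in unitBox {v | v ∉ S'} ×ˢ Set.univ, torusIntegrandC n K W Φ s p ∂(νA.prod νK)) *
          partialPairL S' β₀ (conjFamily β₀) s := by
    filter_upwards [hstrip] with s hs
    rw [hunf P f hη hΦS hΦ0 hΦm hs.1 hs.2, hEuler s hs.1]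
    ring
  exact exists_ne_zero_tendsto_mul_of_eventuallyEq hI hA hCℓ hr hIAL

/-- **Arthur–Clozel (2.3) from the local Rankin–Selberg theory at `s = 1` alone.** Jacquet–Shalika's
strict bound `|a| < q_v^{1/2}` (I, Cor. (2.5)) is a theorem of the tree — local components
(`exists_hasLocalComponentAt_holds`), Flath (`Flath1979_isSatakeParameter_of_hasLocalComponentAt_holds`),
genericity of cuspidal local components (`Shalika1974_isGeneric_of_hasLocalComponentAt_holds`) and the
local bound for unitary generic representations (`JacquetShalika1981_norm_lt_sqrt_of_isGeneric_holds`) —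
so the named fact `JacquetShalika1981_partialPairL_pole_of_eq_conj` follows from the single local input
`hloc` of `JacquetShalika1981_partialPairL_pole_of_eq_conj_of_local`: the convergence to a non-zero limit
at `s = 1` of the `S'`-parts `Ψ_{S'}(s)` of the unfolded Rankin–Selberg integrals of the data (I, §1, §3).
[cite: ArthurClozelAMS120, Ch. 3 §2 (2.3)] [cite: JacquetShalikaAJM1981, §1, §3, §4; II Prop. 3.6] -/
theorem JacquetShalika1981_partialPairL_pole_of_eq_conj_of_local_rankinSelberg
    (hloc : ∀ [MeasurableSpace (AdeleRing (𝓞 K) K)] [BorelSpace (AdeleRing (𝓞 K) K)]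
      (P : CuspidalAutomorphicRepGL n K μ') (f : P.1.toSubmodule)
      (η : (AdelicGroupData.gl n K).Adelic → ℝ) (_hη : IsTestFunctionGL n K η)
      (S' : Set (HeightOneSpectrum (𝓞 K))) (_hS' : S'.Finite)
      (νA : Measure (Fin n → ideleGroup K)) (_ : IsHaarMeasure νA)
      (νK : Measure ↥(maximalCompactAdelic n K)) (_ : IsHaarMeasure νK)
      (ν₀ : Measure ↥(adelicUnipotent n K)) (_ : IsHaarMeasure ν₀),
      ∃ ℓ : ℂ, ℓ ≠ 0 ∧
        Tendsto (fun s : ℂ => ∫ p in unitBox {v | v ∉ S'} ×ˢ Set.univ, torusIntegrandC n K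
            (whittakerCoeff ν₀ (unipotentTateDomain n K) (adeleAddChar K)
              (invQuot (AdelicGroupData.gl n K) (smoothedForm η (f : (AdelicGroupData.gl n K).L2 μ'))))
            (standardTestFun n K (gaussArchTestFun n K)) s p ∂(νA.prod νK))
          (𝓝[{s : ℂ | 1 < s.re}] 1) (𝓝 ℓ)) :
    JacquetShalika1981_partialPairL_pole_of_eq_conj (n := n) (K := K) (μ := μ') :=
  JacquetShalika1981_partialPairL_pole_of_eq_conj_of_local
    (fun P _ _ hα _ hv _ ha => norm_satakeParameter_lt_sqrt_of_isGeneric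
      exists_hasLocalComponentAt_holds Flath1979_isSatakeParameter_of_hasLocalComponentAt_holds
      Shalika1974_isGeneric_of_hasLocalComponentAt_holds
      (fun _ _ _ _ _ => JacquetShalika1981_norm_lt_sqrt_of_isGeneric_holds) P hα hv ha)
    hloc

end Local

end Literature.NumberTheory.Automorphic
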